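import Mathlib
import HarnessLib
import Literature.RepresentationTheory.AlgebraicGroups.FormsCoeffAction
import Literature.RepresentationTheory.CompactGroups.UnitaryTrick
import Literature.MathematicalPhysics.QuantumLattice.GaugeGroups

/-!
# Haar averaging over `SU(σ)` of polynomials in the coefficients of forms

The analytic half of the Reynolds operator for `SL(σ, ℂ)` acting on the coordinate ring of the
space `V_m` of forms of degree `m` (Mumford–Fogarty–Kirwan, *Geometric Invariant Theory*, Ch. 1
§1 Def. 1.5 and §2 proof of Thm. 1.1, where it is obtained from linear reductivity; here it is
produced by Weyl's unitarian trick, i.e. by integration over the compact real form `SU(σ)` —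
Weyl, *The Classical Groups*, Ch. VIII §11; Goodman–Wallach, GTM 255, §3.3.4).

For a polynomial `F` in the coefficient coordinates `(σ →₀ ℕ) → ℂ` (file `FormsCoeffAction`,
action `A ◇ v = coeffVec (linSubst σ ℂ A (∑ d ∈ degMonomials σ m, monomial d (v d)))`) we prove:

* `U ↦ F(U ◇ v)` and the coefficients of the pull-back `F ∘ (U ◇ ·)` are continuous on
  `SU(σ)` (they are polynomials in the matrix entries), hence Haar integrable;
* **averaging** (`exists_haarAverage`): for `F` homogeneous of degree `j` there is a polynomial
  `E`, homogeneous of degree `j`, with `E(v) = ∫_{SU(σ)} F(U ◇ v) dU` for every `v`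
  (coefficientwise Haar average of the pull-backs, normalised Haar measure `haarMeasure ⊤`);
* **invariance** (`integral_aeval_act_mul_eq`): `v ↦ ∫ F(U ◇ v) dU` is `SU(σ)`-invariant, by
  right invariance of Haar measure on the compact group `SU(σ)`
  (`CompactGroup.integral_mul_right_eq_self_of_isHaarMeasure`).

No definitions are introduced; the compactness / Borel structure of `SU(σ)` come from
`Literature.MathematicalPhysics.QuantumLattice.GaugeGroups`. All statements are proved.
-/

noncomputable section

open MvPolynomial MeasureTheory MeasureTheory.Measure TopologicalSpace
open Literature.Computability.AlgebraicComplexity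
open Literature.RepresentationTheory.CompactGroups

namespace Literature.RepresentationTheory.AlgebraicGroups

variable {σ : Type*} [Fintype σ] [DecidableEq σ] (m : ℕ)

/-- The matrix entries of `U ∈ SU(σ)`, as a point of `σ × σ → ℂ`, depend continuously on `U`.
[folklore] -/
theorem continuous_specialUnitaryGroup_entries :
    Continuous fun U : Matrix.specialUnitaryGroup σ ℂ => fun p : σ × σ =>
      (U : Matrix σ σ ℂ) p.1 p.2 :=
  continuous_pi fun p => (continuous_subtype_val (p := fun A : Matrix σ σ ℂ =>
    A ∈ Matrix.specialUnitaryGroup σ ℂ)).matrix_elem p.1 p.2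

/-- `U ↦ F(U ◇ v)` is continuous on `SU(σ)` (it is a polynomial in the entries of `U`,
`eval_aeval_genericCoeff`). [folklore] -/
theorem continuous_aeval_act (F : MvPolynomial (σ →₀ ℕ) ℂ) (v : (σ →₀ ℕ) → ℂ) :
    Continuous fun U : Matrix.specialUnitaryGroup σ ℂ =>
      aeval (coeffVec (linSubst σ ℂ (U : Matrix σ σ ℂ)
        (∑ d ∈ degMonomials σ m, monomial d (v d)))) F := by
  have h := (MvPolynomial.continuous_eval
    (aeval (fun d : σ →₀ ℕ => ∑ d' ∈ degMonomials σ m, v d' • coeff d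
      (linSubst σ (MvPolynomial (σ × σ) ℂ) (Matrix.mvPolynomialX σ σ ℂ) (monomial d' 1))) F)).comp
    (continuous_specialUnitaryGroup_entries (σ := σ))
  refine h.congr fun U => ?_
  exact eval_aeval_genericCoeff m F (U : Matrix σ σ ℂ) v

/-- The coefficients of the pull-back `F ∘ (U ◇ ·)` are continuous functions of `U ∈ SU(σ)`
(polynomials in the entries, `eval_coeff_genericPullback`). [folklore] -/
theorem continuous_coeff_pullback (F : MvPolynomial (σ →₀ ℕ) ℂ) (α : (σ →₀ ℕ) →₀ ℕ) :
    Continuous fun U : Matrix.specialUnitaryGroup σ ℂ =>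
      coeff α (aeval (fun d : σ →₀ ℕ => ∑ d' ∈ degMonomials σ m,
        C (coeff d (linSubst σ ℂ (U : Matrix σ σ ℂ) (monomial d' 1))) * X d') F) := by
  have h := (MvPolynomial.continuous_eval (coeff α
      (bind₁ (fun d : σ →₀ ℕ => ∑ d' ∈ degMonomials σ m, C (coeff d (linSubst σ
          (MvPolynomial (σ × σ) ℂ) (Matrix.mvPolynomialX σ σ ℂ) (monomial d' 1))) * X d')
        (map (C : ℂ →+* MvPolynomial (σ × σ) ℂ) F)))).comp
    (continuous_specialUnitaryGroup_entries (σ := σ))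
  refine h.congr fun U => ?_
  exact eval_coeff_genericPullback m F (U : Matrix σ σ ℂ) α

/-- **Haar averaging.** For a polynomial `F` in the coefficients of degree-`m` forms,
homogeneous of degree `j`, the Haar average `v ↦ ∫_{SU(σ)} F(U ◇ v) dU` is again a polynomial,
homogeneous of degree `j` (average the coefficients of the pull-backs `F ∘ (U ◇ ·)`, which are
homogeneous of degree `j` in the degree-`m` variables). This is the Reynolds operator of
Mumford–Fogarty–Kirwan Ch. 1 §1 Def. 1.5 for `SL(σ, ℂ)` on `ℂ[V_m]`, realised by the unitarian
trick (Weyl 1939 Ch. VIII §11). [cite: MumfordFogartyKirwan1994, Ch. 1 §1 Def. 1.5] -/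
theorem exists_haarAverage (F : MvPolynomial (σ →₀ ℕ) ℂ) {j : ℕ} (hF : F.IsHomogeneous j) :
    ∃ E : MvPolynomial (σ →₀ ℕ) ℂ, E.IsHomogeneous j ∧
      ∀ v : (σ →₀ ℕ) → ℂ, aeval v E =
        ∫ U : Matrix.specialUnitaryGroup σ ℂ,
          aeval (coeffVec (linSubst σ ℂ (U : Matrix σ σ ℂ)
            (∑ d ∈ degMonomials σ m, monomial d (v d)))) F ∂(haarMeasure ⊤) := by
  set μ : Measure (Matrix.specialUnitaryGroup σ ℂ) := haarMeasure ⊤ with hμ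
  set S : Finset ((σ →₀ ℕ) →₀ ℕ) := (degMonomials σ m).finsuppAntidiag j with hS
  -- the pull-back of `F` along `U`
  set pull : Matrix.specialUnitaryGroup σ ℂ → MvPolynomial (σ →₀ ℕ) ℂ := fun U =>
    aeval (fun d : σ →₀ ℕ => ∑ d' ∈ degMonomials σ m,
      C (coeff d (linSubst σ ℂ (U : Matrix σ σ ℂ) (monomial d' 1))) * X d') F with hpull
  set c : ((σ →₀ ℕ) →₀ ℕ) → ℂ := fun α => ∫ U, coeff α (pull U) ∂μ with hc
  refine ⟨∑ α ∈ S, monomial α (c α), ?_, fun v => ?_⟩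
  · refine IsHomogeneous.sum _ _ _ fun α hα => isHomogeneous_monomial _ ?_
    rw [hS, Finset.mem_finsuppAntidiag] at hα
    rw [Finsupp.degree_apply, ← hα.1]
    exact Finset.sum_subset hα.2 fun x _ hx => Finsupp.notMem_support_iff.1 hx
  · -- weights `w α = v^α`
    set w : ((σ →₀ ℕ) →₀ ℕ) → ℂ := fun α => α.prod fun n e => v n ^ e with hw
    have hexp : ∀ U : Matrix.specialUnitaryGroup σ ℂ,
        aeval (coeffVec (linSubst σ ℂ (U : Matrix σ σ ℂ)
          (∑ d ∈ degMonomials σ m, monomial d (v d)))) F =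
        ∑ α ∈ S, coeff α (pull U) * w α := by
      intro U
      rw [← aeval_pullback m F (U : Matrix σ σ ℂ) v, aeval_eq_eval, eval_eq]
      refine Finset.sum_subset (support_pullback_subset m hF (U : Matrix σ σ ℂ)) ?_
      intro α _ hα
      rw [notMem_support_iff.1 hα, zero_mul]
    have hint : ∀ α : (σ →₀ ℕ) →₀ ℕ, Integrable (fun U => coeff α (pull U) * w α) μ := fun α =>
      (CompactGroup.integrable_of_continuous (continuous_coeff_pullback m F α)).mul_const _
    simp_rw [hexp]
    rw [integral_finsetSum S fun α _ => hint α, _root_.map_sum]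
    refine Finset.sum_congr rfl fun α _ => ?_
    rw [aeval_monomial, integral_mul_const, Algebra.algebraMap_self_apply]

/-- **`SU(σ)`-invariance of Haar averages.** For `U₀ ∈ SU(σ)`,
`∫ F(U ◇ (U₀ ◇ v)) dU = ∫ F(U ◇ v) dU`, because `U ◇ (U₀ ◇ v) = (U U₀) ◇ v` and Haar measure on
the compact group `SU(σ)` is right invariant. [folklore] -/
theorem integral_aeval_act_act_eq (F : MvPolynomial (σ →₀ ℕ) ℂ) {U₀ : Matrix σ σ ℂ}
    (hU₀ : U₀ ∈ Matrix.specialUnitaryGroup σ ℂ) (v : (σ →₀ ℕ) → ℂ) :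
    ∫ U : Matrix.specialUnitaryGroup σ ℂ,
        aeval (coeffVec (linSubst σ ℂ (U : Matrix σ σ ℂ) (∑ d ∈ degMonomials σ m, monomial d
          (coeffVec (linSubst σ ℂ U₀ (∑ d' ∈ degMonomials σ m, monomial d' (v d'))) d)))) F
        ∂(haarMeasure ⊤) =
      ∫ U : Matrix.specialUnitaryGroup σ ℂ,
        aeval (coeffVec (linSubst σ ℂ (U : Matrix σ σ ℂ)
          (∑ d ∈ degMonomials σ m, monomial d (v d)))) F ∂(haarMeasure ⊤) := by
  have h := CompactGroup.integral_mul_right_eq_self_of_isHaarMeasure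
    (haarMeasure (⊤ : PositiveCompacts (Matrix.specialUnitaryGroup σ ℂ)))
    (fun U : Matrix.specialUnitaryGroup σ ℂ => aeval (coeffVec (linSubst σ ℂ (U : Matrix σ σ ℂ)
      (∑ d ∈ degMonomials σ m, monomial d (v d)))) F) ⟨U₀, hU₀⟩
  refine Eq.trans ?_ h
  refine integral_congr_ae (Filter.Eventually.of_forall fun U => ?_)
  simp only [Submonoid.coe_mul]
  rw [act_mul]

/-- `U ↦ F(U ◇ v)` is Haar integrable on `SU(σ)`. [folklore] -/
theorem integrable_aeval_act (F : MvPolynomial (σ →₀ ℕ) ℂ) (v : (σ →₀ ℕ) → ℂ) :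
    Integrable (fun U : Matrix.specialUnitaryGroup σ ℂ =>
      aeval (coeffVec (linSubst σ ℂ (U : Matrix σ σ ℂ)
        (∑ d ∈ degMonomials σ m, monomial d (v d)))) F)
      (haarMeasure (⊤ : PositiveCompacts (Matrix.specialUnitaryGroup σ ℂ))) :=
  CompactGroup.integrable_of_continuous (continuous_aeval_act m F v)

/-- The normalised Haar measure of `SU(σ)` is a probability measure (total mass one), so the
average of a constant is the constant. [folklore] -/
theorem integral_const_specialUnitaryGroup (c : ℂ) :
    ∫ _U : Matrix.specialUnitaryGroup σ ℂ, c
      ∂(haarMeasure (⊤ : PositiveCompacts (Matrix.specialUnitaryGroup σ ℂ))) = c := by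
  haveI := CompactGroup.isProbabilityMeasure_haarMeasure_top
    (G := Matrix.specialUnitaryGroup σ ℂ)
  simp

end Literature.RepresentationTheory.AlgebraicGroups

end
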